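import Summits.QuantumFields.YangMills.Theorems.BalabanUVNodesN12NearFlatDelta2Letter

/-!
# DAG node N12 [B15] — THE LETTER (δ₂) PER COMPONENT, WITH NEAR-FLATNESS ON THAT COMPONENT's TOWER ONLY:
# `‖(DΨ_{𝐁,W,U₀}(0)w)_i − (DΦ♭(0)w)_i‖ ≤ C·δ·p(w)` as soon as `‖↑U₀_b − 1‖ ≤ δ` on `feeds j_i c_i` — the gauge-dependent comparison row of the chart of record localised to ONE tower
# (dag-n12-c's LOCATED-GEOM v3 (X2) ∕ DIRECT road step (ii): «module E on the WINDOW TOWERS ONLY»)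

Cell `pub-ymgap` (HUMAN RULINGS D-0062 ∕ D-0149), width seat `pub-ymgap-dag-n12-w4` g5 (the (δ₂) lineage p618836 ∕ p620953 of this seat).  Key K1⁹ `stmt-QuantumFields-27364`,
`--kind proof --supports … --as helper`; count-neutral; THEOREMS ONLY (0 `def`, 0 `sorry`, 0 `instance`).  WHY: the local edition `exists_delta2_letter_local` (p620953) asks near-flatness on
`inputs 𝐁` — every tower of every constrained bond, ≈ all fine bonds of `Ω₁(Z)` at the record, which a ring-shaped `Ω₁(Z)` with holonomy forbids (LOCATED-GEOM v3, n12-c's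
`B15Prop1HolonomyObstruction`).  The `i`-th component of the chart reads `U` only on the tower `feeds j_i c_i` ([III] (2.11), this seat's `Node00.MultiScaleFibreChartLocalityComponent`), so the
`i`-th row of (δ₂) needs near-flatness THERE only: flatten `U₀` off the tower (`Node00.exists_nearFlat_eqOn`), re-label the fibre by the proxy's own averages (the `(j_i, c_i)` average is
unchanged by `iter_local`), apply the global letter p618836 `exists_delta2_letter` to the proxy, and read the `i`-th component.  CONSUMED BY NAME: `exists_delta2_letter`, `exists_guard_of_nearFlat`
(p618836 ∕ p620953), `Node00.exists_nearFlat_eqOn` (p620013), `Node00.exists_uniform_chartCurvature_sq_bound` (p615328: the `SmallBelow` guard of a near-flat field), `Node00.differentiableAt_msChart`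
(p610492), n07-w2's `Node00.msChart_apply` ∕ `relAvg`, `B14.Eq216Concrete.iter_local`.

THE PRINT.  [Balaban1989LargeFieldII] p. 357 («U₀ = exp(iA₀) with A₀ small on the domain Z»), (1.12)–(1.13) p. 359; [Balaban1988Convergent] (2.11) p. 256 (locality of `M^j`: the average at a
`j`-bond depends on the field on its tower only); [Balaban1985Variational] (47) p. 285, (81)–(83) p. 290.

CONTENTS.  §1 `fderiv_apply_eq_fderiv_component` (the `i`-th component of `DΨ(0)w` is the derivative of the `i`-th component), ★ `msChart_apply_eq_of_eqOn_feeds_of_fibre`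
(`Ψ_{𝐁,W,U₀}(X)_i = Ψ_{𝐁,M˙U′,U′}(X)_i` for ALL `X` when `U′ = U₀` on the tower and `W` is `U₀`'s fibre label).  §2 ★★★ `exists_delta2_letter_component` — ONE `C ≥ 0`, `ρ > 0` per height:
for every `𝐁` with no member above `k ≤ m + K`, every `W`, `U₀` in the fibre with `Ψ_{𝐁,W,U₀}` differentiable at `0`, every index `i` and `0 ≤ δ < ρ` with `‖↑U₀_b − 1‖ ≤ δ` on `feeds j_i c_i`:
`‖(DΨ_{𝐁,W,U₀}(0)w)_i − (DΦ♭(0)w)_i‖ ≤ C·δ·p(w)` for every `w`; `exists_delta2_letter_component_Bj` (at `𝐁_k(Z)`).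

HONEST FRAMING.  Composition BY NAME over landed kernel theorems; per-height existence constants (NOT print's volume-uniform `O(1)`); nothing of Bałaban's asserted; N12 NOT discharged;
K1⁹ NOT closed; count-neutral (typed 28∕28 · discharged 5∕27 unmoved); one finite 𝕋⁴ programme at fixed ε — R4 closes the conditional rung `BalabanLadder.UV` only; the YM mass gap (Clay) is
NOT proved by any of this.
-/

noncomputable section

open scoped BigOperators Matrix.Norms.L2Operator Topology
open Filter Finset

namespace Summit.QuantumFields.YangMills.BalabanUVNodes.N12NearFlatDelta2LetterComponent

open Literature.MathematicalPhysics.QuantumFieldTheory.Balaban1983to89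
open T4Continuum (T4Family)
open BlockAveragingEMLLinearised (linAvg)
open T4AdjointCovarianceUnitary (lieSU)
open B15DeterminingSets
open B14.Eq213DetSet (Bj)
open B14.Eq216Concrete (feeds inputs iter_local)
open Node00
open Summit.QuantumFields.YangMills.BalabanUVNodes.N12NearFlatDelta2Letter (exists_delta2_letter exists_guard_of_nearFlat)

variable {F : T4Family} {N : ℕ} [NeZero N] {K k : ℕ}

/-! ## §1  Component bookkeeping -/

omit [NeZero N] in
/-- The `i`-th component of `DΨ(0)w` is the derivative at `0` of the `i`-th component of `Ψ` (for `Ψ` differentiable at `0`). [cite: Balaban1985Variational, (82)–(83) p.290 (bookkeeping)] -/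
theorem fderiv_apply_eq_fderiv_component {n : ℕ} {Ψ : (PBond (F.P K) 0 → lieSU (Fin N)) → Fin n → lieSU (Fin N)} (hΨ : DifferentiableAt ℝ Ψ 0)
    (i : Fin n) (w : PBond (F.P K) 0 → lieSU (Fin N)) :
    fderiv ℝ Ψ 0 w i = fderiv ℝ (fun X => Ψ X i) 0 w := by
  have hπ : HasFDerivAt (fun X => Ψ X i)
      ((ContinuousLinearMap.proj (R := ℝ) i : (Fin n → lieSU (Fin N)) →L[ℝ] lieSU (Fin N)).comp (fderiv ℝ Ψ 0)) 0 :=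
    (ContinuousLinearMap.proj (R := ℝ) i : (Fin n → lieSU (Fin N)) →L[ℝ] lieSU (Fin N)).hasFDerivAt.comp 0 hΨ.hasFDerivAt
  rw [hπ.fderiv]; rfl

/-- ★ **THE `i`-TH COMPONENT READS `U` ON ITS TOWER AND `W` AT ITS OWN INDEX**: if `U′ = U₀` on `feeds j_i c_i` and `W` is `U₀`'s fibre label on `𝐁` (`M_𝐁(U₀) = W`), then for EVERY `X`
`Ψ_{𝐁,W,U₀}(X)_i = Ψ_{𝐁,M˙U′,U′}(X)_i` — the averages of `U₀·e^X` and `U′·e^X` at `(j_i, c_i)` agree by locality ([III] (2.11), `iter_local`), and so do the labels `W_{j_i}(c_i) = M˙(U₀)_{j_i}(c_i) =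
M˙(U′)_{j_i}(c_i)`. [cite: Balaban1988Convergent, (2.11) p.256, (2.10) p.256; Balaban1985Variational, (47) p.285] -/
theorem msChart_apply_eq_of_eqOn_feeds_of_fibre (hk : k ≤ (F.P K).m + (F.P K).K) {𝔹 : DetSet (F.P K)} {W : MSField (F.P K) (SU N)}
    {U₀ U' : GaugeField (F.P K) 0 (SU N)} (hU : AgreeOn 𝔹 (avgFamily (avOfRecord F N K) U₀) W) (i : Fin (constrCard 𝔹 k))
    (hin : ∀ b ∈ feeds (((constrEnum 𝔹 k).symm i).1 : ℕ) ((constrEnum 𝔹 k).symm i).2.1, U' b = U₀ b) (X : PBond (F.P K) 0 → lieSU (Fin N)) :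
    msChart F N K k 𝔹 W U₀ X i = msChart F N K k 𝔹 (avgFamily (avOfRecord F N K) U') U' X i := by
  have hj : (((constrEnum 𝔹 k).symm i).1 : ℕ) ≤ (F.P K).m + (F.P K).K := (Nat.le_of_lt_succ ((constrEnum 𝔹 k).symm i).1.2).trans hk
  have hW : W (((constrEnum 𝔹 k).symm i).1 : ℕ) ((constrEnum 𝔹 k).symm i).2.1
      = avgFamily (avOfRecord F N K) U' (((constrEnum 𝔹 k).symm i).1 : ℕ) ((constrEnum 𝔹 k).symm i).2.1 := by
    rw [← hU _ _ ((constrEnum 𝔹 k).symm i).2.2]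
    exact iter_local (avOfRecord F N K) _ hj _ _ _ fun b hb => (hin b hb).symm
  have hav : avgFamily (avOfRecord F N K) (expChart U₀ X) (((constrEnum 𝔹 k).symm i).1 : ℕ) ((constrEnum 𝔹 k).symm i).2.1
      = avgFamily (avOfRecord F N K) (expChart U' X) (((constrEnum 𝔹 k).symm i).1 : ℕ) ((constrEnum 𝔹 k).symm i).2.1 :=
    iter_local (avOfRecord F N K) _ hj _ _ _ fun b hb => by unfold expChart; rw [hin b hb]
  rw [msChart_apply, msChart_apply, relAvg, relAvg, hW, hav]

/-! ## §2  The letter (δ₂) per component -/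

/-- ★★★ **THE LETTER (δ₂), COMPONENT EDITION** — ONE `C ≥ 0` and ONE `ρ > 0` per height: for every determining set `𝐁` with no member above `k ≤ m + K`, every datum `W`, every `U₀` IN THE
FIBRE with `Ψ_{𝐁,W,U₀}` differentiable at `0`, every constrained index `i` and every `0 ≤ δ < ρ` with `‖↑U₀_b − 1‖ ≤ δ` ON THE TOWER `feeds j_i c_i` ONLY:
`‖(DΨ_{𝐁,W,U₀}(0)w)_i − (DΨ_{𝐁,M˙1,1}(0)w)_i‖ ≤ C·δ·p(w)` for every `w`.  (p618836's global letter at the proxy `U′ := U₀` on the tower, `1` off it — globally `δ`-near-flat, guarded by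
`exists_guard_of_nearFlat` ∕ the `SmallBelow` radius of `exists_uniform_chartCurvature_sq_bound`, in its own fibre `M˙U′` — and §1's component identity.)  No hypothesis on `U₀` off the tower.
[cite: Balaban1989LargeFieldII, p.357, (1.12)–(1.13) p.359; Balaban1988Convergent, (2.11)–(2.13) pp.256–257; Balaban1985Variational, (47) p.285, (81)–(83) p.290] -/
theorem exists_delta2_letter_component (k : ℕ)
    (Q : (i : ℕ) → (PBond (F.P K) 0 → Matrix (Fin N) (Fin N) ℂ) → PBond (F.P K) i → Matrix (Fin N) (Fin N) ℂ)
    (hQ0 : ∀ Y, Q 0 Y = Y) (hQs : ∀ (i : ℕ) (Y : PBond (F.P K) 0 → Matrix (Fin N) (Fin N) ℂ) (c : PBond (F.P K) (i + 1)), Q (i + 1) Y c = linAvg (Q i Y) c)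
    (p : Seminorm ℝ (PBond (F.P K) 0 → lieSU (Fin N)))
    (hp : ∀ Y : PBond (F.P K) 0 → lieSU (Fin N), ∑ b, ‖(Y b : Matrix (Fin N) (Fin N) ℂ)‖ ^ 2 ≤ p Y ^ 2) :
    ∃ C ρ : ℝ, 0 ≤ C ∧ 0 < ρ ∧
      ∀ (𝔹 : DetSet (F.P K)) (W : MSField (F.P K) (SU N)) (U₀ : GaugeField (F.P K) 0 (SU N)),
        (∀ j, k < j → 𝔹 j = ∅) → k ≤ (F.P K).m + (F.P K).K →
        AgreeOn 𝔹 (avgFamily (avOfRecord F N K) U₀) W → DifferentiableAt ℝ (msChart F N K k 𝔹 W U₀) 0 →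
        ∀ (i : Fin (constrCard 𝔹 k)) ⦃δ : ℝ⦄, 0 ≤ δ → δ < ρ →
        (∀ b ∈ feeds (((constrEnum 𝔹 k).symm i).1 : ℕ) ((constrEnum 𝔹 k).symm i).2.1, ‖((U₀ b : SU N) : Matrix (Fin N) (Fin N) ℂ) - 1‖ ≤ δ) →
        ∀ w : PBond (F.P K) 0 → lieSU (Fin N),
          ‖fderiv ℝ (msChart F N K k 𝔹 W U₀) 0 w i
              - fderiv ℝ (msChart F N K k 𝔹 (avgFamily (avOfRecord F N K) (1 : GaugeField (F.P K) 0 (SU N))) (1 : GaugeField (F.P K) 0 (SU N))) 0 w i‖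
            ≤ C * δ * p w := by
  obtain ⟨C, ρ₁, hC, hρ₁, h⟩ := exists_delta2_letter (F := F) (N := N) (K := K) k Q hQ0 hQs p hp
  obtain ⟨t₀, ρg, ht₀, hst, hρg, hguard⟩ := exists_guard_of_nearFlat (F := F) (N := N) K k
  obtain ⟨_, ρ'', _, hρ'', hsb, _⟩ := exists_uniform_chartCurvature_sq_bound (F := F) (N := N) (K := K) k
  refine ⟨C, min ρ₁ (min ρg ρ''), hC, lt_min hρ₁ (lt_min hρg hρ''), fun 𝔹 W U₀ _ hk hU hΨ i δ hδ0 hδρ hloc w => ?_⟩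
  -- the proxy: `U₀` on the tower, `1` elsewhere
  obtain ⟨U', hin, hflat⟩ := Node00.exists_nearFlat_eqOn U₀ _ hδ0 hloc
  have hρ1 : δ < ρ₁ := lt_of_lt_of_le hδρ (min_le_left _ _)
  have hρ2 : δ ≤ ρg := (le_of_lt hδρ).trans ((min_le_right _ _).trans (min_le_left _ _))
  have hρ3 : δ ≤ ρ'' := (le_of_lt hδρ).trans ((min_le_right _ _).trans (min_le_right _ _))
  have hg : ∀ i', i' < k → PlaqSmall t₀ (Averaging.iter (avOfRecord F N K) i' U') := fun i' hi' => hguard U' (hflat.trans hρ2) i' hi'.le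
  have hlt : ‖coeField U' - 1‖ < ρ₁ := lt_of_le_of_lt hflat hρ1
  have hAgr : AgreeOn 𝔹 (avgFamily (avOfRecord F N K) U') (avgFamily (avOfRecord F N K) U') := fun _ _ _ => rfl
  -- the global letter at the proxy in its own fibre
  have key := h ht₀ hst U' 𝔹 (avgFamily (avOfRecord F N K) U') hg hlt hAgr w
  have keyi : ‖fderiv ℝ (msChart F N K k 𝔹 (avgFamily (avOfRecord F N K) U') U') 0 w i
      - fderiv ℝ (msChart F N K k 𝔹 (avgFamily (avOfRecord F N K) (1 : GaugeField (F.P K) 0 (SU N))) (1 : GaugeField (F.P K) 0 (SU N))) 0 w i‖ ≤ C * δ * p w := by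
    rw [← Pi.sub_apply]
    exact (norm_le_pi_norm _ i).trans (key.trans (mul_le_mul_of_nonneg_right (mul_le_mul_of_nonneg_left hflat hC) (apply_nonneg p w)))
  -- the component identity `(DΨ_{W,U₀}(0)w)_i = (DΨ_{M˙U′,U′}(0)w)_i`
  have hΨ' : DifferentiableAt ℝ (msChart F N K k 𝔹 (avgFamily (avOfRecord F N K) U') U') 0 := differentiableAt_msChart hAgr (hsb U' (hflat.trans hρ3))
  have hfun : (fun X => msChart F N K k 𝔹 W U₀ X i) = fun X => msChart F N K k 𝔹 (avgFamily (avOfRecord F N K) U') U' X i :=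
    funext fun X => msChart_apply_eq_of_eqOn_feeds_of_fibre hk hU i hin X
  have hcomp : fderiv ℝ (msChart F N K k 𝔹 W U₀) 0 w i = fderiv ℝ (msChart F N K k 𝔹 (avgFamily (avOfRecord F N K) U') U') 0 w i := by
    rw [fderiv_apply_eq_fderiv_component hΨ, fderiv_apply_eq_fderiv_component hΨ', hfun]
  rw [hcomp]
  exact keyi

/-- ★★ **THE SAME AT THE RECORD's DETERMINING SET `𝐁_k(Z) = Bj M₁ Z k`** (no member above `k`): the (δ₂) row of the chart letter (χ) ∕ the direct road, component by component, with near-flatness of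
`U₀` asked only on the tower of that component. [cite: Balaban1989LargeFieldII, p.357, (1.12) p.359; Balaban1988Convergent, (2.11)–(2.13) pp.256–257] -/
theorem exists_delta2_letter_component_Bj (k M₁ : ℕ) (Z : Set (Site (F.P K) 0))
    (Q : (i : ℕ) → (PBond (F.P K) 0 → Matrix (Fin N) (Fin N) ℂ) → PBond (F.P K) i → Matrix (Fin N) (Fin N) ℂ)
    (hQ0 : ∀ Y, Q 0 Y = Y) (hQs : ∀ (i : ℕ) (Y : PBond (F.P K) 0 → Matrix (Fin N) (Fin N) ℂ) (c : PBond (F.P K) (i + 1)), Q (i + 1) Y c = linAvg (Q i Y) c)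
    (p : Seminorm ℝ (PBond (F.P K) 0 → lieSU (Fin N)))
    (hp : ∀ Y : PBond (F.P K) 0 → lieSU (Fin N), ∑ b, ‖(Y b : Matrix (Fin N) (Fin N) ℂ)‖ ^ 2 ≤ p Y ^ 2) :
    ∃ C ρ : ℝ, 0 ≤ C ∧ 0 < ρ ∧
      ∀ (W : MSField (F.P K) (SU N)) (U₀ : GaugeField (F.P K) 0 (SU N)), k ≤ (F.P K).m + (F.P K).K →
        AgreeOn (Bj M₁ Z k) (avgFamily (avOfRecord F N K) U₀) W → DifferentiableAt ℝ (msChart F N K k (Bj M₁ Z k) W U₀) 0 →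
        ∀ (i : Fin (constrCard (Bj M₁ Z k) k)) ⦃δ : ℝ⦄, 0 ≤ δ → δ < ρ →
        (∀ b ∈ feeds (((constrEnum (Bj M₁ Z k) k).symm i).1 : ℕ) ((constrEnum (Bj M₁ Z k) k).symm i).2.1, ‖((U₀ b : SU N) : Matrix (Fin N) (Fin N) ℂ) - 1‖ ≤ δ) →
        ∀ w : PBond (F.P K) 0 → lieSU (Fin N),
          ‖fderiv ℝ (msChart F N K k (Bj M₁ Z k) W U₀) 0 w i
              - fderiv ℝ (msChart F N K k (Bj M₁ Z k) (avgFamily (avOfRecord F N K) (1 : GaugeField (F.P K) 0 (SU N))) (1 : GaugeField (F.P K) 0 (SU N))) 0 w i‖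
            ≤ C * δ * p w := by
  obtain ⟨C, ρ, hC, hρ, h⟩ := exists_delta2_letter_component (F := F) (N := N) (K := K) k Q hQ0 hQs p hp
  exact ⟨C, ρ, hC, hρ, fun W U₀ hk hU hΨ i δ hδ0 hδρ hloc w => h (Bj M₁ Z k) W U₀ (fun _ hj => B14.Eq213DetSet.Bj_of_gt hj) hk hU hΨ i hδ0 hδρ hloc w⟩

end Summit.QuantumFields.YangMills.BalabanUVNodes.N12NearFlatDelta2LetterComponent

end
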